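import Literature.IUT.HodgeTheaters.PuncturedEllipticCoveringsCor12InertiaCentralOfCuspGalois
import Literature.IUT.HodgeTheaters.PuncturedEllipticCoveringsArrowClaimsOfLaws
import Literature.AnabelianGeometry.AbsoluteAnabelian.FreeProSigmaCompletionBridge
import Mathlib.GroupTheory.Subgroup.Centralizer
import Mathlib.Algebra.Group.Subgroup.Basic
import Mathlib.Topology.Algebra.Group.ClosedSubgroup
import Mathlib.Tactic.Group
import HarnessLib

/-!
# [IUTchI] §1 p. 37–38: the cusp-span sentence (CS) «`⁅Δ_X, Δ_X⁆⁻` dies in `Δ_E ⊗ ℤ/l`» DERIVED from the single relation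
# (REL′) «the zero cusp's inertia lies in the span of the other cusps' inertia» — proof-only

Mochizuki, *Inter-universal Teichmüller theory I*, kurims manuscript (May 2020), §1 p. 37 l. 30 – p. 38 l. 1 ("`Δ_X̲ ↠ Δ_X̲^{ab} ⊗
(ℤ/lℤ) ↠ Δ_ε` … `0 → I_ε′ × I_ε″ → Δ_ε → Δ_E ⊗ (ℤ/lℤ) → 0`") [cite: Mochizuki2012, IUTchI §1 pp.37-38] (D-0012 claim key; series
status DISPUTED — nothing of the series is asserted here); [AbsTopI] Lemma 4.5 (i) p. 54 (`IsFreeProOn`) [cite: MochizukiAbsTopI2012,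
Lemma 4.5 (i) p.54].

PROOF-ONLY file (cell abc-iut, seat abc-iut-L5-t1 gen 11, self-row «COR12-CS-OF-REL»; GAP-LEDGER G-L5t1g11-4; sequel of
`…Cor12IotaNegOfOrigin` (p502003: the law (L3) ⟸ `GeomOriginIota` + (CS))).  With `T := I_ε′ ⊔ I_ε″ ⊔ Ker(Δ_X̲ ↠ Δ_ε)` — i.e.
`Ker(Δ_X̲ ↠ Δ_X̲^{ab} ⊗ ℤ/l)` together with the inertia groups of ALL typed nonzero cusps — this file proves
  **(CS) `⁅Δ_X, Δ_X⁆⁻ ≤ T`** from (A) «`Δ_X` free profinite on `a, b`» + (c′) «every `I_x` a `Δ_X`-conjugate of `⟨[a,b]⟩⁻`»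
  (abc-iut-L5-t1's `GeomOrigin` fields), the cusp action `C : CuspGalois` (p424023), the datum's field (∗) `star` (through the
  THEOREM (L4) `CuspGalois.inertia_central_of_star_freePro`, abc-iut-L5-t1 p500241 / abc-iut-w4-d051 p501910) and ONE relation:
  **(REL′) `I_{ε⁰} ≤ T`** — «the zero cusp's class lies in the span of the other cusp classes in `H₁(X̲; 𝔽_l)`», the image of
  the surface relation `[α,β]·∏_c γ_c = 1` of `Δ_X̲` (abc-iut-w6-d032's (O1)/transfer product read in `Δ_X̲^{ab} ⊗ ℤ/l`).
PROOF.  (1) `T ⊇ Ker(↠)` has finite index in `Δ_X̲` ((L0), abc-iut-f-090 `modLKer_relIndex_ne_zero_of_isFreeProOn`), so `T` is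
open-closed in `Δ_X̲`, hence CLOSED (`closedSpan_isClosed`).  (2) `T` is `Δ_X`-NORMAL (`conj_mem_closedSpan`): for `g ∈ Δ_X` and
`z ∈ I_x`, `act_decomp` gives `t ∈ Π_X̲` with `z″ := (t g) z (t g)⁻¹ ∈ I_{g·x}`, so `g z g⁻¹ = [t⁻¹, z″]·z″ ∈ Ker·I_{g·x} ⊆ T` by
(L4) — the case `g·x = ε⁰` being (REL′).  (3) `[a,b] ∈ T` (`I_{ε⁰} = g₀⟨[a,b]⟩⁻g₀⁻¹` and (2)), so `T` pulls back along
`F₂ → Δ_X` to a normal subgroup containing `[x₀, x₁]`, hence `⁅F₂, F₂⁆` (`F₂/⟨⟨[x₀,x₁]⟩⟩` is abelian: two commuting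
generators, `Subgroup.closureCommGroupOfComm`); (4) `⟨a,b⟩` is dense (`IsFreeProOn.dense_range_lift`) and `(p,q) ↦ [p,q]` is
continuous into the closed `T`, so `[p,q] ∈ T` for all `p, q ∈ Δ_X`; closedness again gives `⁅Δ_X,Δ_X⁆⁻ ≤ T`.  ∎
EFFECT on the [IUTchI] Cor. 1.2 closer of record: the LAW (L3) ↦ (CS) (p502003) ↦ (REL′); the residual becomes the cusp-line
arithmetic {(L2a), (L2c), (REL′)} ×2 (+ (O1) for `h0`, abc-iut-w6-d032), all outputs of abc-iut-L5-d4's shadow (R45).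

HONEST FRAMING: classical profinite group theory over hypothesis/origin binders asserted for no instance; (REL′) is displayed,
not proved; no `def`, no instance, no new `Prop` fact; nothing here bears on [IUTchIII] Cor. 3.12 or asserts that abc is proved
or refuted.
-/

noncomputable section

open Topology

namespace Literature.IUT.HodgeTheaters

namespace PuncturedEllipticData

namespace CuspGalois

open Literature.AnabelianGeometry.AbsoluteAnabelian

universe u

variable {D : PuncturedEllipticData.{u}} (C : D.CuspGalois)

/-! ### §1. The span `T = I_ε′ ⊔ I_ε″ ⊔ Ker(Δ_X̲ ↠ Δ_ε)`: every typed cusp, closedness -/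

omit C in
/-- `Ker(Δ_X̲ ↠ Δ_X̲^{ab} ⊗ ℤ/l) ≤ T`. ([IUTchI] §1 p.37) [claim: Mochizuki2012, status: disputed] -/
theorem modLKer_le_span : D.modLKer ≤ D.inertia D.ε1 ⊔ D.inertia D.ε2 ⊔ D.deltaEpsKer :=
  le_sup_of_le_right (by unfold PuncturedEllipticData.deltaEpsKer; exact le_sup_left)

omit C in
/-- Under (REL′), the inertia group of EVERY typed cusp lies in `T` (the nonzero cusps by definition of `Ker(Δ_X̲ ↠ Δ_ε)`).
([IUTchI] §1 p.37) [claim: Mochizuki2012, status: disputed] -/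
theorem inertia_le_span (hrel : D.inertia D.ε0 ≤ D.inertia D.ε1 ⊔ D.inertia D.ε2 ⊔ D.deltaEpsKer) (x : D.Cusp) :
    D.inertia x ≤ D.inertia D.ε1 ⊔ D.inertia D.ε2 ⊔ D.deltaEpsKer := by
  by_cases h0 : x = D.ε0
  · subst h0; exact hrel
  by_cases h1 : x = D.ε1
  · subst h1; exact le_sup_of_le_left le_sup_left
  by_cases h2 : x = D.ε2
  · subst h2; exact le_sup_of_le_left le_sup_right
  refine le_sup_of_le_right ?_
  unfold PuncturedEllipticData.deltaEpsKer
  exact le_sup_of_le_right (le_iSup_of_le ⟨x, h0, h1, h2⟩ le_rfl)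

omit C in
/-- `T ≤ Δ_X̲`. ([IUTchI] §1 p.37) [claim: Mochizuki2012, status: disputed] -/
theorem span_le_deltaXbar : D.inertia D.ε1 ⊔ D.inertia D.ε2 ⊔ D.deltaEpsKer ≤ D.DeltaXbar :=
  sup_le (sup_le (D.inertia_le_deltaXbar _) (D.inertia_le_deltaXbar _)) D.deltaEpsKer_le_deltaXbar

omit C in
/-- **`T` is CLOSED** when `Δ_X` is free profinite of finite rank: `T ⊇ Ker(Δ_X̲ ↠ Δ_X̲^{ab} ⊗ ℤ/l)`, a closed subgroup of
finite index in `Δ_X̲` ((L0)), so `T` is open, hence closed, in the closed subgroup `Δ_X̲`.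
([IUTchI] §1 p.37) [claim: Mochizuki2012, status: disputed] -/
theorem isClosed_span {n : ℕ} {gens : Fin n → ↥(D.PiX ⊓ D.DeltaC)}
    (hfree : IsFreeProOn ↥(D.PiX ⊓ D.DeltaC) Set.univ gens) :
    IsClosed ((D.inertia D.ε1 ⊔ D.inertia D.ε2 ⊔ D.deltaEpsKer : Subgroup D.PiC) : Set D.PiC) := by
  set T := D.inertia D.ε1 ⊔ D.inertia D.ε2 ⊔ D.deltaEpsKer with hT
  have hXc : IsClosed ((D.DeltaXbar : Subgroup D.PiC) : Set D.PiC) := D.isClosed_deltaXbar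
  have hemb : Topology.IsClosedEmbedding ((↑) : ↥D.DeltaXbar → D.PiC) := hXc.isClosedEmbedding_subtypeVal
  -- inside `Δ_X̲`: `Ker` is closed of finite index, hence open; `T ⊇ Ker` is open, hence closed
  haveI hfi : (D.modLKer.subgroupOf D.DeltaXbar).FiniteIndex := ⟨D.modLKer_relIndex_ne_zero_of_isFreeProOn hfree⟩
  have hMc : IsClosed ((D.modLKer.subgroupOf D.DeltaXbar : Subgroup ↥D.DeltaXbar) : Set ↥D.DeltaXbar) := by
    rw [Subgroup.coe_subgroupOf]
    exact (Subgroup.isClosed_topologicalClosure _).preimage continuous_subtype_val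
  have hMo := Subgroup.isOpen_of_isClosed_of_finiteIndex _ hMc
  have hle : D.modLKer.subgroupOf D.DeltaXbar ≤ T.subgroupOf D.DeltaXbar := fun x hx => by
    rw [Subgroup.mem_subgroupOf] at hx ⊢
    exact modLKer_le_span hx
  have hTo : IsOpen ((T.subgroupOf D.DeltaXbar : Subgroup ↥D.DeltaXbar) : Set ↥D.DeltaXbar) :=
    Subgroup.isOpen_mono hle hMo
  have hTc' : IsClosed ((T.subgroupOf D.DeltaXbar : Subgroup ↥D.DeltaXbar) : Set ↥D.DeltaXbar) :=
    Subgroup.isClosed_of_isOpen _ hTo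
  have hmap : (T.subgroupOf D.DeltaXbar).map D.DeltaXbar.subtype = T :=
    Subgroup.map_subgroupOf_eq_of_le span_le_deltaXbar
  rw [← hmap, Subgroup.coe_map, Subgroup.coe_subtype]
  exact hemb.isClosedMap _ hTc'

/-! ### §2. `T` is normalised by `Δ_X` -/

include C in
/-- **`T` is normal in `Π_C`** under (REL′): `g I_x g⁻¹ ⊆ Ker · I_{g·x}` by `act_decomp` and the theorem
(L4). ([IUTchI] §1 p.38) [claim: Mochizuki2012, status: disputed] -/
theorem conj_mem_span {gens : Fin 2 → ↥(D.PiX ⊓ D.DeltaC)}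
    (hfree : IsFreeProOn ↥(D.PiX ⊓ D.DeltaC) Set.univ gens)
    (hcusp : ∀ x : D.Cusp, ∃ g ∈ D.PiX ⊓ D.DeltaC,
      D.inertia x = (Subgroup.zpowers (g * ((gens 0 : D.PiC) * (gens 1 : D.PiC) *
        (gens 0 : D.PiC)⁻¹ * (gens 1 : D.PiC)⁻¹) * g⁻¹)).topologicalClosure)
    (hrel : D.inertia D.ε0 ≤ D.inertia D.ε1 ⊔ D.inertia D.ε2 ⊔ D.deltaEpsKer)
    (g : D.PiC) {t : D.PiC} (ht : t ∈ D.inertia D.ε1 ⊔ D.inertia D.ε2 ⊔ D.deltaEpsKer) :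
    g * t * g⁻¹ ∈ D.inertia D.ε1 ⊔ D.inertia D.ε2 ⊔ D.deltaEpsKer := by
  set T := D.inertia D.ε1 ⊔ D.inertia D.ε2 ⊔ D.deltaEpsKer with hT
  haveI hMn : D.modLKer.Normal := C.normal_modLKer
  have hL4 := C.inertia_central_of_star_freePro hfree hcusp
  -- `T ≤ comap (conj g) T`, piece by piece
  let φ : D.PiC →* D.PiC := (MulAut.conj g).toMonoidHom
  have hφ : ∀ z : D.PiC, φ z = g * z * g⁻¹ := fun z => MulAut.conj_apply g z
  have hI : ∀ x : D.Cusp, D.inertia x ≤ T.comap φ := by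
    intro x z hz
    rw [Subgroup.mem_comap, hφ]
    obtain ⟨s, hs, hz''⟩ := C.exists_conj_inertia_mem g x hz
    have hid : g * z * g⁻¹ = (s⁻¹ * ((s * g) * z * (s * g)⁻¹) * s⁻¹⁻¹ * ((s * g) * z * (s * g)⁻¹)⁻¹) *
        ((s * g) * z * (s * g)⁻¹) := by group
    rw [hid]
    exact mul_mem (modLKer_le_span (hL4 _ s⁻¹ (inv_mem hs) _ hz'')) (inertia_le_span hrel _ hz'')
  have hM : D.modLKer ≤ T.comap φ := fun z hz => by
    rw [Subgroup.mem_comap, hφ]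
    exact modLKer_le_span (hMn.conj_mem z hz g)
  have hK : D.deltaEpsKer ≤ T.comap φ := by
    unfold PuncturedEllipticData.deltaEpsKer
    exact sup_le hM (iSup_le fun x => hI x.1)
  have hTle : T ≤ T.comap φ := sup_le (sup_le (hI _) (hI _)) hK
  have h := hTle ht
  rwa [Subgroup.mem_comap, hφ] at h

/-! ### §3. (CS) from (REL′) -/

omit C in
/-- In the free group on two letters the commutator subgroup is the normal closure of `[x₀, x₁]` (the quotient is generated
by two commuting elements). [folklore] -/
private theorem commutator_freeGroup_le_normalClosure :
    ⁅(⊤ : Subgroup (FreeGroup (Fin 2))), ⊤⁆ ≤ Subgroup.normalClosure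
      {FreeGroup.of (0 : Fin 2) * FreeGroup.of 1 * (FreeGroup.of 0)⁻¹ * (FreeGroup.of 1)⁻¹} := by
  classical
  set N := Subgroup.normalClosure
    ({FreeGroup.of (0 : Fin 2) * FreeGroup.of 1 * (FreeGroup.of 0)⁻¹ * (FreeGroup.of 1)⁻¹} : Set (FreeGroup (Fin 2)))
    with hN
  haveI : N.Normal := Subgroup.normalClosure_normal
  -- the quotient is commutative: generated by the commuting images of the two letters
  set k : Set (FreeGroup (Fin 2) ⧸ N) := Set.range (fun i : Fin 2 => (QuotientGroup.mk (FreeGroup.of i) : FreeGroup (Fin 2) ⧸ N))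
    with hk
  have hxy : (QuotientGroup.mk (FreeGroup.of (0 : Fin 2)) : FreeGroup (Fin 2) ⧸ N) * QuotientGroup.mk (FreeGroup.of 1) =
      QuotientGroup.mk (FreeGroup.of 1) * QuotientGroup.mk (FreeGroup.of 0) := by
    rw [← QuotientGroup.mk_mul, ← QuotientGroup.mk_mul, QuotientGroup.eq]
    have hmem : FreeGroup.of (0 : Fin 2) * FreeGroup.of 1 * (FreeGroup.of 0)⁻¹ * (FreeGroup.of 1)⁻¹ ∈ N :=
      Subgroup.subset_normalClosure (Set.mem_singleton _)
    have he : (FreeGroup.of (0 : Fin 2) * FreeGroup.of 1)⁻¹ * (FreeGroup.of 1 * FreeGroup.of 0) =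
        (FreeGroup.of 1 * FreeGroup.of 0)⁻¹ *
          (FreeGroup.of 0 * FreeGroup.of 1 * (FreeGroup.of 0)⁻¹ * (FreeGroup.of 1)⁻¹)⁻¹ *
            (FreeGroup.of 1 * FreeGroup.of 0) := by group
    rw [he]
    exact (Subgroup.normalClosure_normal).conj_mem' _ (inv_mem hmem) _
  have hcomm : ∀ u ∈ k, ∀ v ∈ k, u * v = v * u := by
    rintro _ ⟨i, rfl⟩ _ ⟨j, rfl⟩
    fin_cases i <;> fin_cases j
    · rfl
    · exact hxy
    · exact hxy.symm
    · rfl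
  have hktop : Subgroup.closure k = ⊤ := by
    have h1 : k = (QuotientGroup.mk' N) '' Set.range (FreeGroup.of : Fin 2 → FreeGroup (Fin 2)) := by
      rw [hk, ← Set.range_comp]; rfl
    rw [h1, ← MonoidHom.map_closure, FreeGroup.closure_range_of, ← MonoidHom.range_eq_map]
    exact MonoidHom.range_eq_top.mpr (QuotientGroup.mk'_surjective N)
  have hall : ∀ u v : FreeGroup (Fin 2) ⧸ N, u * v = v * u := by
    have h1 : Subgroup.closure k ≤ Subgroup.centralizer k :=
      (Subgroup.closure_le _).mpr fun u hu => Subgroup.mem_centralizer_iff.mpr fun v hv => hcomm v hv u hu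
    have h2 : k ⊆ Subgroup.centralizer (Subgroup.closure k : Set (FreeGroup (Fin 2) ⧸ N)) := fun v hv =>
      Subgroup.mem_centralizer_iff.mpr fun u hu => ((Subgroup.mem_centralizer_iff.mp (h1 hu)) v hv).symm
    have h3 : Subgroup.closure k ≤ Subgroup.centralizer (Subgroup.closure k : Set (FreeGroup (Fin 2) ⧸ N)) :=
      (Subgroup.closure_le _).mpr h2
    intro u v
    have hu : u ∈ Subgroup.closure k := by rw [hktop]; exact Subgroup.mem_top u
    have hv : v ∈ Subgroup.closure k := by rw [hktop]; exact Subgroup.mem_top v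
    exact ((Subgroup.mem_centralizer_iff.mp (h3 hu)) v hv).symm
  rw [Subgroup.commutator_le]
  intro p _ q _
  rw [commutatorElement_def, ← QuotientGroup.eq_one_iff (N := N), QuotientGroup.mk_mul, QuotientGroup.mk_mul,
    QuotientGroup.mk_mul, QuotientGroup.mk_inv, QuotientGroup.mk_inv,
    hall (QuotientGroup.mk p : FreeGroup (Fin 2) ⧸ N) (QuotientGroup.mk q), mul_inv_cancel_right, mul_inv_cancel]

include C in
/-- **(CS) from (REL′)**: if the zero cusp's inertia lies in `T = I_ε′ ⊔ I_ε″ ⊔ Ker(Δ_X̲ ↠ Δ_ε)` (the span of all other cusp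
classes), then `⁅Δ_X, Δ_X⁆⁻ ≤ T` — «the commutators of `Δ_X` die in `Δ_E ⊗ ℤ/l`»; with abc-iut-L5-t1's
`GeomOriginIota.iota_neg_of_closure_commutator_le` (p502003) this yields the law (L3) `ModLCuspLaws.iota_neg`.
([IUTchI] §1 p.38) [claim: Mochizuki2012, status: disputed] -/
theorem closure_commutator_le_span_of_inertia_ε0_le {gens : Fin 2 → ↥(D.PiX ⊓ D.DeltaC)}
    (hfree : IsFreeProOn ↥(D.PiX ⊓ D.DeltaC) Set.univ gens)
    (hcusp : ∀ x : D.Cusp, ∃ g ∈ D.PiX ⊓ D.DeltaC,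
      D.inertia x = (Subgroup.zpowers (g * ((gens 0 : D.PiC) * (gens 1 : D.PiC) *
        (gens 0 : D.PiC)⁻¹ * (gens 1 : D.PiC)⁻¹) * g⁻¹)).topologicalClosure)
    (hrel : D.inertia D.ε0 ≤ D.inertia D.ε1 ⊔ D.inertia D.ε2 ⊔ D.deltaEpsKer) :
    (⁅D.PiX ⊓ D.DeltaC, D.PiX ⊓ D.DeltaC⁆).topologicalClosure ≤
      D.inertia D.ε1 ⊔ D.inertia D.ε2 ⊔ D.deltaEpsKer := by
  classical
  set T := D.inertia D.ε1 ⊔ D.inertia D.ε2 ⊔ D.deltaEpsKer with hT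
  have hTc : IsClosed (T : Set D.PiC) := isClosed_span hfree
  have hΔc : IsClosed ((D.PiX ⊓ D.DeltaC : Subgroup D.PiC) : Set D.PiC) := D.isClosed_piX_inf_deltaC
  haveI : CompactSpace ↥(D.PiX ⊓ D.DeltaC) := isCompact_iff_compactSpace.mp hΔc.isCompact
  -- `[a,b] ∈ T`
  obtain ⟨g₀, hg₀, hI0⟩ := hcusp D.ε0
  have hcT : (gens 0 : D.PiC) * (gens 1 : D.PiC) * (gens 0 : D.PiC)⁻¹ * (gens 1 : D.PiC)⁻¹ ∈ T := by
    have hw : g₀ * ((gens 0 : D.PiC) * (gens 1 : D.PiC) * (gens 0 : D.PiC)⁻¹ * (gens 1 : D.PiC)⁻¹) * g₀⁻¹ ∈ T :=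
      hrel (by rw [hI0]; exact Subgroup.le_topologicalClosure _ (Subgroup.mem_zpowers _))
    have he : g₀⁻¹ * (g₀ * ((gens 0 : D.PiC) * (gens 1 : D.PiC) * (gens 0 : D.PiC)⁻¹ * (gens 1 : D.PiC)⁻¹) * g₀⁻¹) *
        g₀⁻¹⁻¹ = (gens 0 : D.PiC) * (gens 1 : D.PiC) * (gens 0 : D.PiC)⁻¹ * (gens 1 : D.PiC)⁻¹ := by group
    rw [← he]
    exact conj_mem_span C hfree hcusp hrel g₀⁻¹ hw
  -- pull back along `F₂ → Δ_X → Π_C`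
  let L : FreeGroup (Fin 2) →* D.PiC := (D.PiX ⊓ D.DeltaC).subtype.comp (FreeGroup.lift gens)
  have hL : ∀ i, L (FreeGroup.of i) = (gens i : D.PiC) := fun i => by simp [L]
  haveI hTn : (T.comap L).Normal := ⟨fun w hw v => by
    rw [Subgroup.mem_comap, map_mul, map_mul, map_inv]
    exact conj_mem_span C hfree hcusp hrel (L v) hw⟩
  have hc0 : FreeGroup.of (0 : Fin 2) * FreeGroup.of 1 * (FreeGroup.of 0)⁻¹ * (FreeGroup.of 1)⁻¹ ∈ T.comap L := by
    rw [Subgroup.mem_comap, map_mul, map_mul, map_mul, map_inv, map_inv, hL, hL]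
    exact hcT
  have hN : Subgroup.normalClosure
      ({FreeGroup.of (0 : Fin 2) * FreeGroup.of 1 * (FreeGroup.of 0)⁻¹ * (FreeGroup.of 1)⁻¹} :
        Set (FreeGroup (Fin 2))) ≤ T.comap L :=
    Subgroup.normalClosure_le_normal (Set.singleton_subset_iff.mpr hc0)
  have hcommF : ⁅(⊤ : Subgroup (FreeGroup (Fin 2))), ⊤⁆ ≤ T.comap L :=
    commutator_freeGroup_le_normalClosure.trans hN
  have hwords : ∀ P Q : FreeGroup (Fin 2), L P * L Q * (L P)⁻¹ * (L Q)⁻¹ ∈ T := by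
    intro P Q
    have h := hcommF (Subgroup.commutator_mem_commutator (Subgroup.mem_top P) (Subgroup.mem_top Q))
    rw [commutatorElement_def, Subgroup.mem_comap, map_mul, map_mul, map_mul, map_inv, map_inv] at h
    exact h
  -- density of `⟨a, b⟩` and continuity of `(p, q) ↦ [p, q]`
  have hdense : Dense (Set.range (FreeGroup.lift gens)) := hfree.dense_range_lift
  have hall : ∀ p q : ↥(D.PiX ⊓ D.DeltaC), (p : D.PiC) * q * (p : D.PiC)⁻¹ * (q : D.PiC)⁻¹ ∈ T := by
    have hκ : Continuous fun pq : ↥(D.PiX ⊓ D.DeltaC) × ↥(D.PiX ⊓ D.DeltaC) =>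
        (pq.1 : D.PiC) * pq.2 * (pq.1 : D.PiC)⁻¹ * (pq.2 : D.PiC)⁻¹ :=
      (((continuous_subtype_val.comp continuous_fst).mul (continuous_subtype_val.comp continuous_snd)).mul
        (continuous_subtype_val.comp continuous_fst).inv).mul (continuous_subtype_val.comp continuous_snd).inv
    have hSc : IsClosed {pq : ↥(D.PiX ⊓ D.DeltaC) × ↥(D.PiX ⊓ D.DeltaC) |
        (pq.1 : D.PiC) * pq.2 * (pq.1 : D.PiC)⁻¹ * (pq.2 : D.PiC)⁻¹ ∈ T} := hTc.preimage hκ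
    have hsub : Set.range (FreeGroup.lift gens) ×ˢ Set.range (FreeGroup.lift gens) ⊆
        {pq : ↥(D.PiX ⊓ D.DeltaC) × ↥(D.PiX ⊓ D.DeltaC) |
          (pq.1 : D.PiC) * pq.2 * (pq.1 : D.PiC)⁻¹ * (pq.2 : D.PiC)⁻¹ ∈ T} := by
      rintro ⟨_, _⟩ ⟨⟨P, rfl⟩, ⟨Q, rfl⟩⟩
      exact hwords P Q
    have hD : Dense (Set.range (FreeGroup.lift gens) ×ˢ Set.range (FreeGroup.lift gens)) := hdense.prod hdense
    intro p q
    have hpq : (p, q) ∈ {pq : ↥(D.PiX ⊓ D.DeltaC) × ↥(D.PiX ⊓ D.DeltaC) |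
        (pq.1 : D.PiC) * pq.2 * (pq.1 : D.PiC)⁻¹ * (pq.2 : D.PiC)⁻¹ ∈ T} :=
      (hSc.closure_subset_iff.mpr hsub) (by rw [hD.closure_eq]; exact Set.mem_univ _)
    exact hpq
  -- `⁅Δ_X, Δ_X⁆ ≤ T`, hence its closure
  have hle : ⁅D.PiX ⊓ D.DeltaC, D.PiX ⊓ D.DeltaC⁆ ≤ T := by
    rw [Subgroup.commutator_le]
    intro p hp q hq
    exact hall ⟨p, hp⟩ ⟨q, hq⟩
  exact Subgroup.topologicalClosure_minimal _ hle hTc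

/-- **(CS) at a `GeomOrigin` record** under (REL′). ([IUTchI] §1 p.38) [claim: Mochizuki2012, status: disputed] -/
theorem _root_.Literature.IUT.HodgeTheaters.PuncturedEllipticData.GeomOrigin.closure_commutator_le_span
    (O : D.GeomOrigin) (C : D.CuspGalois)
    (hrel : D.inertia D.ε0 ≤ D.inertia D.ε1 ⊔ D.inertia D.ε2 ⊔ D.deltaEpsKer) :
    (⁅D.PiX ⊓ D.DeltaC, D.PiX ⊓ D.DeltaC⁆).topologicalClosure ≤
      D.inertia D.ε1 ⊔ D.inertia D.ε2 ⊔ D.deltaEpsKer :=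
  C.closure_commutator_le_span_of_inertia_ε0_le O.isFreeProOn O.inertia_eq_conj_commutator hrel

end CuspGalois

end PuncturedEllipticData

end Literature.IUT.HodgeTheaters

end
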